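import Mathlib
import Literature.Computability.AlgebraicComplexity.GroupTheoreticMatMulThmBProofs
import Summits.MatrixMultiplication.MatrixMultiplication.Theorems.BoundedExponentThird.Negative.TwoLegBound

set_option linter.dupNamespace false

/-!
# Symmetrisation of an asymmetric thin design (stub `stub_symmetrise`, line `tame-charts`)

Stub `stub_symmetrise` of the line `tame-charts` for the crux
`Summit.MatrixMultiplication.MatrixMultiplication.Theses.ThinBlockAlpha.BoundedExponentThird`.

An ASYMMETRIC thin STPP design — blocks `⟨N₁, M, N₂⟩` in a finite abelian group `H` of exponent
`≤ ℓ`, thinness `(N₁N₂)^{1/3} ≤ M²`, two-leg slack `|H| ≤ L · (N₁N₂)^{1+η}` — yields the crux's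
symmetric slack level `DesignAt ℓ (2η)`: take the product of the family with its REVERSAL
`(A, B, C) ↦ (−C, −B, −A)` inside `H × H`, indexed by `Fin (L·L) ≃ Fin L × Fin L`
(`finProdFinEquiv`).  The blocks become `⟨N₁N₂, M·M, N₂N₁⟩`, the group `H × H` still has exponent
`≤ ℓ`, and `|H × H| = |H|² ≤ (L·L) · (N₁N₂)^{2+2η}`.

* `stub_symmetrise_isSTPP_reverse` — the reversal preserves `IsSTPP` (its relation at indices
  `(i, j, k)` is the original relation at `(j, i, k)`, negated);
* `stub_symmetrise_exponent_prod_self_le` — `exp (Z × Z) ≤ exp Z`;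
* `stub_symmetrise` — the registered stub (products and sub-families of STPP families are STPP:
  `isSTPP_iff_addSimultaneousTPP`, `AddSimultaneousTPP.prod`, `AddSimultaneousTPP.comp`).
-/

namespace Summit.MatrixMultiplication.MatrixMultiplication.Theorems.BoundedExponentThird.TameCharts

open scoped Pointwise
open Literature.Computability.AlgebraicComplexity
open Summit.MatrixMultiplication.MatrixMultiplication.Theorems.BoundedExponentThird.Negative (DesignAt)

/-- **Reversal symmetry.** `(A, B, C) ↦ (−C, −B, −A)` preserves the STPP (read the defining relation
backwards: the instance `(j, i, k)` of the original family). -/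
theorem stub_symmetrise_isSTPP_reverse {H : Type*} [AddCommGroup H] [DecidableEq H] {L : ℕ}
    {A B C : Fin L → Finset H} (h : IsSTPP A B C) :
    IsSTPP (fun i => -(C i)) (fun i => -(B i)) (fun i => -(A i)) := by
  intro i j k s hs s' hs' t ht t' ht' u hu u' hu' h0
  simp only [Finset.mem_neg'] at hs hs' ht ht' hu hu'
  have e : (-u - -u') + (-t - -t') + (-s - -s') = (s' - s) + (t' - t) + (u' - u) := by abel
  obtain ⟨hji, hik, hS, hT, hV⟩ := h j i k (-u') hu' (-u) hu (-t') ht' (-t) ht (-s') hs' (-s) hs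
    (by rw [e, h0])
  refine ⟨hji.symm, hji ▸ hik, ?_, ?_, ?_⟩
  · exact (neg_injective hV).symm
  · exact (neg_injective hT).symm
  · exact (neg_injective hS).symm

/-- Exponent of a square: `exp (Z × Z) ≤ exp Z` for a finite abelian group `Z` (every element of
`Z × Z` is killed by `exp Z`, coordinatewise). -/
theorem stub_symmetrise_exponent_prod_self_le {Z : Type} [AddCommGroup Z] [Fintype Z] :
    AddMonoid.exponent (Z × Z) ≤ AddMonoid.exponent Z := by
  refine AddMonoid.exponent_min' _ (AddMonoid.exponent_pos.2 AddMonoid.ExponentExists.of_finite)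
    fun g => ?_
  ext <;> simp [AddMonoid.exponent_nsmul_eq_zero]

/-- **Symmetrisation** (stub `stub_symmetrise` of the line `tame-charts`). An asymmetric thin design
— an `IsSTPP` family of blocks `⟨N₁, M, N₂⟩` in a finite abelian group `H` of exponent `≤ ℓ` with
`N₁N₂ ≥ 2`, thinness `(N₁N₂)^{1/3} ≤ M²` and two-leg slack `|H| ≤ L · (N₁N₂)^{1+η}` — gives the
symmetric slack level `DesignAt ℓ (2η)`: the product of the family with its reversal
`(−C, −B, −A)` in `H × H`, indexed by `Fin (L·L)`, has blocks `⟨N₁N₂, M·M, N₁N₂⟩`, lives in a group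
of exponent `≤ ℓ`, and `|H × H| = |H|² ≤ (L·L) · (N₁N₂)^{2+2η}`. -/
theorem stub_symmetrise (ℓ : ℕ) (η : ℝ)
    (h : ∃ (H : Type) (_ : AddCommGroup H) (_ : Fintype H) (L N₁ M N₂ : ℕ)
      (A B C : Fin L → Finset H),
      AddMonoid.exponent H ≤ ℓ ∧ IsSTPP A B C ∧
      (∀ i, (A i).card = N₁ ∧ (B i).card = M ∧ (C i).card = N₂) ∧ 2 ≤ N₁ * N₂ ∧
      ((N₁ * N₂ : ℕ) : ℝ) ^ (1 / 3 : ℝ) ≤ (M : ℝ) ^ 2 ∧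
      (Fintype.card H : ℝ) ≤ L * ((N₁ * N₂ : ℕ) : ℝ) ^ (1 + η)) :
    DesignAt ℓ (2 * η) := by
  obtain ⟨H, iH, iHf, L, N₁, M, N₂, A, B, C, hexp, hS, hc, hN2, hNM, hslack⟩ := h
  classical
  -- the product of the family with its reversal, indexed by `Fin (L * L)`
  let e : Fin (L * L) → Fin L × Fin L := fun q => finProdFinEquiv.symm q
  have he : Function.Injective e := finProdFinEquiv.symm.injective
  let A' : Fin (L * L) → Finset (H × H) := fun q => A (e q).1 ×ˢ (-(C (e q).2))
  let B' : Fin (L * L) → Finset (H × H) := fun q => B (e q).1 ×ˢ (-(B (e q).2))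
  let C' : Fin (L * L) → Finset (H × H) := fun q => C (e q).1 ×ˢ (-(A (e q).2))
  have hS' : IsSTPP A' B' C' := by
    have h1 := (isSTPP_iff_addSimultaneousTPP A B C).1 hS
    have h2 := (isSTPP_iff_addSimultaneousTPP _ _ _).1 (stub_symmetrise_isSTPP_reverse hS)
    have hp := (h1.prod h2).comp he
    exact (isSTPP_iff_addSimultaneousTPP A' B' C').2 hp
  refine ⟨H × H, inferInstance, inferInstance, L * L, N₁ * N₂, M * M, A', B', C',
    stub_symmetrise_exponent_prod_self_le.trans hexp, hS', fun q => ⟨?_, ?_, ?_⟩, hN2, ?_, ?_⟩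
  · simp only [A', Finset.card_product, Finset.card_neg, (hc _).1, (hc _).2.2]
  · simp only [B', Finset.card_product, Finset.card_neg, (hc _).2.1]
  · simp only [C', Finset.card_product, Finset.card_neg, (hc _).1, (hc _).2.2, mul_comm]
  · -- thinness: `N^{1/3} ≤ M·M` is the hypothesis `(N₁N₂)^{1/3} ≤ M²`
    have hMM : ((M * M : ℕ) : ℝ) = (M : ℝ) ^ 2 := by push_cast; ring
    rw [hMM]
    exact hNM
  · -- the two-leg inequality: `|H|² ≤ (L·L) · N^{2+2η}`, the square of the hypothesis
    rw [Fintype.card_prod]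
    have hN0 : (0 : ℝ) < ((N₁ * N₂ : ℕ) : ℝ) := by exact_mod_cast (by omega : 0 < N₁ * N₂)
    have hH0 : (0 : ℝ) ≤ (Fintype.card H : ℝ) := Nat.cast_nonneg _
    have hsq : (Fintype.card H : ℝ) * (Fintype.card H : ℝ) ≤
        ((L : ℝ) * ((N₁ * N₂ : ℕ) : ℝ) ^ (1 + η)) * ((L : ℝ) * ((N₁ * N₂ : ℕ) : ℝ) ^ (1 + η)) :=
      mul_le_mul hslack hslack hH0 (hH0.trans hslack)
    have e2 : ((L : ℝ) * ((N₁ * N₂ : ℕ) : ℝ) ^ (1 + η)) * ((L : ℝ) * ((N₁ * N₂ : ℕ) : ℝ) ^ (1 + η)) =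
        ((L * L : ℕ) : ℝ) * ((N₁ * N₂ : ℕ) : ℝ) ^ (2 + 2 * η) := by
      have h22 : (2 + 2 * η : ℝ) = (1 + η) + (1 + η) := by ring
      rw [h22, Real.rpow_add hN0 (1 + η) (1 + η), Nat.cast_mul L L]
      ring
    calc ((Fintype.card H * Fintype.card H : ℕ) : ℝ)
        = (Fintype.card H : ℝ) * (Fintype.card H : ℝ) := Nat.cast_mul _ _
      _ ≤ _ := hsq
      _ = ((L * L : ℕ) : ℝ) * ((N₁ * N₂ : ℕ) : ℝ) ^ (2 + 2 * η) := e2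

end Summit.MatrixMultiplication.MatrixMultiplication.Theorems.BoundedExponentThird.TameCharts
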